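import Summits.QuantumFields.YangMills.Theorems.FemtoTransferGap
import HarnessLib

/-!
# The one-site model INSIDE the `L³` lattice: spatially constant configurations (support module for the fixed-lattice statements
# COARSE±(L₀) / BO(L₀) of route `LuscherReduction` — crux RED `RunningReduction`, stmt-QuantumFields-19978, KT-door stub 3b′; and S-BASE of
# crux `TwistedTraceScaling`, stmt-QuantumFields-20203)

Two tree docstrings assert it informally (`FemtoTransferGapReduction`: «the Wilson action of a spatially constant configuration on `(ℤ/L)³` is
exactly `L³` times the one-site action»; `…BOHandover`: «the `L0³` kernel restricted to spatially constant configurations IS the one-site kernel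
at `L0³β`»); this module PROVES it, for any group `G` and any matrix representation `ρ`, together with the symmetry half that every
Born–Oppenheimer comparison of the `L³` lattice with the one-site model needs:

* `constLift L U` — the spatially constant (zero-momentum) extension of a one-site configuration `U : GaugeConfig 3 1 G` (three link variables)
  to the torus `(ℤ/L)³`: every link in direction `i` carries `U_i`.
* `plaquetteHolonomy_constLift`, `wilsonAction_constLift : S_L(constLift U) = L³ · S_1(U)`, `timeCoupling_constLift`, and
  `transferKernel_constLift : K^{(L)}_β(constLift U, constLift V) = K^{(1)}_{L³β}(U, V)` — the `L³` lattice kernel on constant configurations is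
  the ONE-SITE kernel at the natural coupling `B' = L³β` (exactly, not asymptotically).
* `gaugeTransform_const_constLift` (a constant gauge transformation acts on constant configurations by the one-site Gauss law = simultaneous
  conjugation) and `gaugeTransform_twist_pow_constLift`: multiplying the one-site link `U_k` by a central `z` lifts to the composite of the centre
  twist by `z^L` through the plane `x_k = 0` and the central-valued gauge transformation `g(x) = z^{−val(x_k − 1)}` — so
* `IsPhys.compConstLift`: the restriction `U ↦ ψ(constLift L U)` of a physical zero-flux test function of the `L³` lattice is a physical
  zero-flux test function of the one-site model (gauge invariance ⇒ conjugation invariance; gauge + twist invariance ⇒ invariance under the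
  one-site centre flips `U_k ↦ zU_k`, for EVERY `L`, even or odd, and every central `z`).

These are the algebraic seams of `BO(L₀)` («lattice-only Born–Oppenheimer comparison», hypothesis of `BOHandover.coarseNoIntruderAt_of_boUpper`)
and of the cut S-BASE ⇐ COARSE±(L₁) + COARSE-TAIL(L₁) (`TwoLattice.Base.fixedLatticeTraceLaw_of_coarse`).  HONEST FRAMING: finite bookkeeping on
`G^{3L³}`; no analysis, no semiclassics, nothing of the RG; femto rung R2b1; not a gap, not Clay.
-/

set_option autoImplicit false

noncomputable section

open MeasureTheory
open Literature.MathematicalPhysics.QuantumFieldTheory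
open Literature.MathematicalPhysics.QuantumLattice

namespace Summit.QuantumFields.YangMills.Theorems.FemtoTransferGap

section Basic

variable {G : Type*}

/-- **Spatially constant lift**: the configuration of the torus `(ℤ/L)³` whose every link in direction `i` equals the one-site link `U_i`
(`U : GaugeConfig 3 1 G`, the one-site model; `(0, i)` is its link in direction `i`). [cite: Luscher1983, §3] -/
def constLift (L : ℕ) (U : GaugeConfig 3 1 G) : GaugeConfig 3 L G :=
  fun e => U (0, e.2)

/-- Links of the constant lift. [folklore] -/
@[simp] theorem constLift_apply (L : ℕ) (U : GaugeConfig 3 1 G) (e : Edge 3 L) : constLift L U e = U (0, e.2) := rfl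

/-- On one site every site is `0`. [folklore] -/
theorem site_one_eq_zero (x : Site 3 1) : x = 0 := Subsingleton.elim _ _

/-- On one site, `U (x, i) = U (0, i)`. [folklore] -/
theorem apply_one_site (U : GaugeConfig 3 1 G) (x : Site 3 1) (i : Fin 3) : U (x, i) = U (0, i) := by
  rw [site_one_eq_zero x]

/-- At `L = 1` the constant lift is the identity. [folklore] -/
theorem constLift_one (U : GaugeConfig 3 1 G) : constLift 1 U = U := by
  funext e
  rw [constLift_apply, ← apply_one_site U e.1 e.2]

/-- The constant lift is measurable (each link is a coordinate projection). [folklore] -/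
theorem measurable_constLift [MeasurableSpace G] (L : ℕ) : Measurable (constLift (G := G) L) :=
  measurable_pi_lambda _ fun e => measurable_pi_apply (0, e.2)

end Basic

section Algebra

variable {N : ℕ} {G : Type*} [Group G]

/-- Plaquette holonomies of a constant configuration are the one-site plaquette holonomies (group commutators `U_i U_j U_i⁻¹ U_j⁻¹`).
[cite: Luscher1983, §3] -/
theorem plaquetteHolonomy_constLift (L : ℕ) (U : GaugeConfig 3 1 G) (x : Site 3 L) (i j : Fin 3) :
    plaquetteHolonomy (constLift L U) x i j = plaquetteHolonomy U 0 i j := by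
  unfold plaquetteHolonomy
  simp only [constLift_apply, apply_one_site U]

variable (ρ : G →* Matrix (Fin N) (Fin N) ℂ)

/-- **`S_L(constLift U) = L³ · S_1(U)`**: the Wilson action of a spatially constant configuration on `(ℤ/L)³` is `L³` times the one-site
action (each of the `L³` sites carries the same three plaquettes). [cite: Luscher1983, §3] -/
theorem wilsonAction_constLift (L : ℕ) [NeZero L] (U : GaugeConfig 3 1 G) :
    wilsonAction ρ (constLift L U) = (L : ℝ) ^ 3 * wilsonAction ρ U := by
  unfold wilsonAction
  rw [Fintype.sum_prod_type, Fintype.sum_prod_type]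
  simp only [plaquetteHolonomy_constLift]
  have h1 : ∀ y : Site 3 1, ∀ q : {p : Fin 3 × Fin 3 // p.1 < p.2},
      ((N : ℝ) - (ρ (plaquetteHolonomy U y q.1.1 q.1.2)).trace.re) =
        ((N : ℝ) - (ρ (plaquetteHolonomy U 0 q.1.1 q.1.2)).trace.re) := fun y q => by rw [site_one_eq_zero y]
  simp only [h1]
  rw [Finset.sum_const, Finset.sum_const, Finset.card_univ, Finset.card_univ, nsmul_eq_mul, nsmul_eq_mul]
  have hc : (Fintype.card (Site 3 L) : ℝ) = (L : ℝ) ^ 3 := by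
    rw [Fintype.card_pi, Finset.prod_const, Finset.card_univ, Fintype.card_fin, ZMod.card]
    push_cast
    ring
  have hc1 : (Fintype.card (Site 3 1) : ℝ) = 1 := by
    rw [Fintype.card_unique, Nat.cast_one]
  rw [hc, hc1, one_mul]

/-- **`tc_L(constLift U, constLift V) = L³ · tc_1(U, V)`** for the time-like coupling `Σₑ Re tr ρ(Uₑ Vₑ⁻¹)`. [cite: SeilerLNP1982, §3] -/
theorem timeCoupling_constLift (L : ℕ) [NeZero L] (U V : GaugeConfig 3 1 G) :
    timeCoupling ρ (constLift L U) (constLift L V) = (L : ℝ) ^ 3 * timeCoupling ρ U V := by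
  unfold timeCoupling
  rw [Fintype.sum_prod_type, Fintype.sum_prod_type]
  simp only [constLift_apply]
  have h1 : ∀ y : Site 3 1, ∀ i : Fin 3, ((ρ (U (y, i) * (V (y, i))⁻¹)).trace).re = ((ρ (U (0, i) * (V (0, i))⁻¹)).trace).re :=
    fun y i => by rw [site_one_eq_zero y]
  simp only [h1]
  rw [Finset.sum_const, Finset.sum_const, Finset.card_univ, Finset.card_univ, nsmul_eq_mul, nsmul_eq_mul]
  have hc : (Fintype.card (Site 3 L) : ℝ) = (L : ℝ) ^ 3 := by
    rw [Fintype.card_pi, Finset.prod_const, Finset.card_univ, Fintype.card_fin, ZMod.card]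
    push_cast
    ring
  have hc1 : (Fintype.card (Site 3 1) : ℝ) = 1 := by
    rw [Fintype.card_unique, Nat.cast_one]
  rw [hc, hc1, one_mul]

/-- ★ **The `L³` lattice transfer kernel on spatially constant configurations IS the one-site kernel at coupling `L³β`**:
`K^{(L)}_β(constLift U, constLift V) = K^{(1)}_{L³β}(U, V)` — exactly. [cite: Luscher1983, §3] [cite: SeilerLNP1982, §3] -/
theorem transferKernel_constLift (L : ℕ) [NeZero L] (β : ℝ) (U V : GaugeConfig 3 1 G) :
    transferKernel ρ β (constLift L U) (constLift L V) = transferKernel ρ ((L : ℝ) ^ 3 * β) U V := by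
  unfold transferKernel
  rw [timeCoupling_constLift, wilsonAction_constLift, wilsonAction_constLift]
  congr 1
  ring

/-- A CONSTANT gauge transformation of the torus acts on constant configurations through the one-site Gauss law (simultaneous
conjugation of the three links). [folklore] -/
theorem gaugeTransform_const_constLift (L : ℕ) (g : G) (U : GaugeConfig 3 1 G) :
    gaugeTransform (fun _ : Site 3 L => g) (constLift L U) = constLift L (gaugeTransform (fun _ : Site 3 1 => g) U) := by
  funext e
  simp only [gaugeTransform, constLift_apply]

/-- On one site every gauge transformation is a constant one. [folklore] -/
theorem gaugeTransform_one_site_eq_const (g : Site 3 1 → G) (U : GaugeConfig 3 1 G) :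
    gaugeTransform g U = gaugeTransform (fun _ : Site 3 1 => g 0) U := by
  funext e
  simp only [gaugeTransform, site_one_eq_zero e.1, site_one_eq_zero (Site.shift _ _)]

/-- On one site the centre twist in direction `k` multiplies the link `U_k` (the plane condition `x_k = 0` is automatic). [folklore] -/
theorem twist_one_site' (k : Fin 3) (z : G) (U : GaugeConfig 3 1 G) (e : Edge 3 1) :
    twist k z U e = if e.2 = k then z * U e else U e := by
  unfold twist
  have h0 : e.1 k = 0 := Subsingleton.elim _ _
  simp only [h0, and_true]

/-- A central element commutes with everything, as do its integer powers. [folklore] -/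
theorem zpow_mul_comm_of_mem_center {z : G} (hz : z ∈ Subgroup.center G) (m : ℤ) (u : G) : z ^ m * u = u * z ^ m := by
  have hm : z ^ m ∈ Subgroup.center G := Subgroup.zpow_mem _ hz m
  exact (Subgroup.mem_center_iff.mp hm u).symm

/-- `val (a + 1) = val a + 1` in `ZMod L` unless `a = −1`. [folklore] -/
theorem zmod_val_add_one_of_ne {L : ℕ} [NeZero L] {a : ZMod L} (h : a ≠ -1) : (a + 1).val = a.val + 1 := by
  have hlt : a.val + 1 < L := by
    have hle : a.val + 1 ≤ L := ZMod.val_lt a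
    rcases hle.lt_or_eq with hlt | heq
    · exact hlt
    · exfalso
      apply h
      have h1 : ((a.val + 1 : ℕ) : ZMod L) = 0 := by rw [heq, ZMod.natCast_self]
      rw [Nat.cast_succ, ZMod.natCast_zmod_val] at h1
      exact eq_neg_of_add_eq_zero_left h1
  have h2 : a + 1 = ((a.val + 1 : ℕ) : ZMod L) := by rw [Nat.cast_succ, ZMod.natCast_zmod_val]
  rw [h2, ZMod.val_natCast_of_lt hlt]

/-- `val (−1) + 1 = L` in `ZMod L`. [folklore] -/
theorem zmod_val_neg_one_add_one (L : ℕ) [NeZero L] : (-1 : ZMod L).val + 1 = L := by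
  obtain ⟨m, hm⟩ := Nat.exists_eq_succ_of_ne_zero (NeZero.ne L)
  subst hm
  rw [ZMod.val_neg_one]

/-- ★ **Centre flips of the one-site model lift to twist ∘ gauge on the torus.**  For central `z` and the central-valued gauge transformation
`g(x) = z^{−val(x_k − 1)}`: `g · twist_k(z^L)(constLift U) = constLift(twist_k(z) U)` — along direction `k` the gauge factors telescope to
`z` on every link except through the plane `x_k = 0`, where they give `z^{1−L}` and the twist supplies the missing `z^L`. [cite: tHooft1979]
[cite: Luscher1983, §2] -/
theorem gaugeTransform_twist_pow_constLift (L : ℕ) [NeZero L] (k : Fin 3) {z : G} (hz : z ∈ Subgroup.center G)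
    (U : GaugeConfig 3 1 G) :
    gaugeTransform (fun x : Site 3 L => z ^ (-(((x k - 1).val : ℤ)))) (twist k (z ^ L) (constLift L U)) =
      constLift L (twist k z U) := by
  funext e
  obtain ⟨x, i⟩ := e
  have hshift : ∀ j : Fin 3, (Site.shift x i) j = x j + (if j = i then 1 else 0) := fun j => by
    simp only [Site.shift, Pi.add_apply, Pi.single_apply]
  simp only [gaugeTransform, constLift_apply, twist]
  -- move the left gauge factor to the right (it is central)
  rw [zpow_mul_comm_of_mem_center hz, mul_assoc, ← zpow_neg, neg_neg]
  by_cases hik : i = k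
  · subst hik
    have hs : Site.shift x i i - 1 = x i := by rw [hshift, if_pos rfl]; abel
    rw [hs]
    simp only [true_and]
    by_cases hx : x i = 0
    · -- through the plane: twist `z^L`, gauge `z^{-(L-1)} · z^{0}`
      rw [if_pos hx, hx, zero_sub, ZMod.val_zero]
      have hv : ((-1 : ZMod L).val : ℤ) = (L : ℤ) - 1 := by
        have := zmod_val_neg_one_add_one L
        omega
      rw [hv]
      simp only [CharP.cast_eq_zero, zpow_zero, mul_one]
      rw [if_pos (show (0 : Site 3 1) i = 0 from Subsingleton.elim _ _), ← zpow_natCast z L, zpow_mul_comm_of_mem_center hz, mul_assoc, ← zpow_add,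
        show (L : ℤ) + -((L : ℤ) - 1) = 1 by ring, zpow_one]
      exact Subgroup.mem_center_iff.mp hz (U (0, i))
    · -- away from the plane: no twist, gauge `z^{-(v-1)} · z^{v}`
      rw [if_neg hx]
      have hne : x i - 1 ≠ -1 := fun h => hx (by
        have := congrArg (· + 1) h
        simpa using this)
      have hv : ((x i).val : ℤ) = (((x i - 1).val : ℤ)) + 1 := by
        have := zmod_val_add_one_of_ne hne
        rw [sub_add_cancel] at this
        omega
      rw [hv, ← zpow_add, show -(((x i - 1).val : ℤ)) + ((((x i - 1).val : ℤ)) + 1) = 1 by ring, zpow_one,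
        if_pos (show (0 : Site 3 1) i = 0 from Subsingleton.elim _ _)]
      exact Subgroup.mem_center_iff.mp hz (U (0, i))
  · have hs : Site.shift x i k = x k := by rw [hshift, if_neg (Ne.symm hik), add_zero]
    rw [hs]
    have hki : ¬ (i = k) := hik
    simp only [hki, false_and, if_false]
    rw [← zpow_add, neg_add_cancel, zpow_zero, mul_one]

end Algebra

section Sector

variable {G : Type*} [Group G] [MeasurableSpace G]

/-- ★ **Restriction of physical zero-flux test functions to constant configurations is physical zero-flux on one site.**  If
`ψ : GaugeConfig 3 L G → ℝ` is bounded, measurable, gauge-invariant and twist-invariant on the torus `(ℤ/L)³`, then `U ↦ ψ(constLift L U)` is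
so on the one-site model: conjugation invariance from constant gauge transformations, centre-flip invariance (`U_k ↦ zU_k`) from the twist by
`z^L` composed with the telescoping gauge transformation of `gaugeTransform_twist_pow_constLift`. [cite: Luscher1983, §2] [cite: tHooft1979] -/
theorem IsPhys.compConstLift (L : ℕ) [NeZero L] {ψ : GaugeConfig 3 L G → ℝ} (hψ : IsPhys ψ) :
    IsPhys (fun U : GaugeConfig 3 1 G => ψ (constLift L U)) where
  measurable := hψ.measurable.comp (measurable_constLift L)
  bounded := by
    obtain ⟨C, hC⟩ := hψ.bounded
    exact ⟨C, fun U => hC _⟩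
  gaugeInv := fun g U => by
    show ψ (constLift L (gaugeTransform g U)) = ψ (constLift L U)
    rw [gaugeTransform_one_site_eq_const, ← gaugeTransform_const_constLift, hψ.gaugeInv]
  zeroFlux := fun k z hz U => by
    show ψ (constLift L (twist k z U)) = ψ (constLift L U)
    rw [← gaugeTransform_twist_pow_constLift L k hz U, hψ.gaugeInv,
      hψ.zeroFlux k (z ^ L) (Subgroup.pow_mem _ hz L)]

end Sector

end Summit.QuantumFields.YangMills.Theorems.FemtoTransferGap

end
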